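import Summits.QuantumFields.BalabanUV.Beta.FP.ScalarAveragingJetLetters
import Summits.QuantumFields.BalabanUV.Beta.FP.AveragingJetLettersRootedSecond

/-!
# `Beta/FP/BondFamilyCovariance` — road «FP» (binder row D1), row KER-γ (α2) sub-row **α2-c** «GHOST», PART 2 helper: BLOCK COVARIANCE OF THE BOND-LETTER
# 0-FORM FAMILY's JET KERNELS — under the DISPLAYED covariance of the path rule (radCov) «the paths of block `u + t` are the paths of block `u` translated by
# `N•t`», the first-jet kernel `ker₁` and the second-jet kernel `ker₂` of `ScalarAveragingJetLetters`' family with bond letters `Pt × Fin 4` are jointly block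
# covariant; the `hGper` inputs of the ghost pieces (`GhostMixPieces`, `GhostMixPieceQuartic`, `GhostMixPieceCubic`, `GhostMixPieceGamma`)

HONEST DEPENDENCY (page 1, mandatory): continuum YM on T⁴ ⇐ BetaPertH ∧ nine spine estimates (0/9 proved); BetaPertH ⇐ (D1) ∧ (D4) ∧
CAP+tail; G-an2-4 gates asym, D1 and NE2/3/4.  HONEST FRAMING (cell contract, verbatim): «discharging `BetaPertH` makes Bałaban's UV
stability UNCONDITIONAL — a real constructive-QFT result; it is NOT the continuum limit and NOT the Clay problem.»  THIS MODULE is [folklore] list∕lattice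
bookkeeping (`List.count_map_of_injective`, `lawful_beq_subsingleton` for the two `BEq` routes on `Pt × Fin 4`, the positional indicator and the nested pair weight
under an injective relabelling); it asserts nothing about Bałaban's objects, cites nothing, mints no `Prop` fact, has no `def`, 0 sorry; 0∕4 row-D1 binders; NOT D1,
NOT BetaPertH, NOT continuum, NOT Clay.

ABSOLUTE RULE (cell charter, verbatim): «No internally-minted statement may enter as a cited fact. Every hypothesis is either kernel-proved in this
package or a verbatim quotation of a PUBLISHED theorem with page reference. The manuscript(s) under audit are NOT citable for their own disputed
steps — they are the thing under adjudication; programme-internal (2001/route/tribunal) claims are never citable.»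

CONTENT ([folklore]): **`ker₁_bond_shift`**, **`posInd_map_of_injective`**, **`pairW_map_of_injective`**, **`ker₂_bond_shift`**.
Provenance: D1 formalisation swarm LEAF PROVER 05, unit `b2b-balaban-beta-d1-formalise-leaf-05` gen 15, 2026-08-21, road FP row KER-γ (α2) sub-row α2-c; «not in print;
our bookkeeping»; no existing file touched.
-/

noncomputable section

namespace Summit.QuantumFields.BalabanUV.Beta.FP.BondFamilyCovariance

open Finset
open scoped BigOperators
open Literature.MathematicalPhysics.QuantumFieldTheory.Balaban1983to89
open Literature.MathematicalPhysics.QuantumFieldTheory.Balaban1983to89.Beta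
open DyadicShell (Pt)
open AxialBlockWeights (fineBlock)
open Summit.QuantumFields.BalabanUV.Beta.FP.AveragingJetLettersRooted (ker₁)
open Summit.QuantumFields.BalabanUV.Beta.FP.AveragingJetLettersRootedSecond (posInd pairW ker₂)
open Summit.QuantumFields.BalabanUV.Beta.FP.ScalarAveragingJetLetters (sclW sclFld sclBg)

variable {σ : Type*} [Fintype σ] {N : ℕ} {p : σ → ℝ} {rad : σ → Pt → Pt → List (Pt × Fin 4)}

/-- [folklore] **THE BOND-LETTER JET KERNEL IS BLOCK COVARIANT** under the DISPLAYED covariance of the path rule (radCov) «the paths of block `u + t` are the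
paths of block `u` translated by `N•t`»: `ker₁^{(u+t)} (b + N•t, c) (x + N•t) = ker₁^{(u)} (b, c) x`. -/
theorem ker₁_bond_shift
    (hradCov : ∀ (s : σ) (u t x' : Pt), rad s (u + t) x' = (rad s u x').map (fun ℓ => (ℓ.1 + (N : ℤ) • t, ℓ.2)))
    (b x : Pt) (c : Fin 4) (u t : Pt) :
    ker₁ (sclW N p) (sclFld N (u + t)) (sclBg N (u + t) rad) (b + (N : ℤ) • t, c) (x + (N : ℤ) • t)
      = ker₁ (sclW N p) (sclFld N u) (sclBg N u rad) (b, c) x := by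
  classical
  unfold ker₁
  have hN : ((N : ℕ) • t : Pt) = (N : ℤ) • t := (Nat.cast_smul_eq_nsmul ℤ N t).symm
  have hfld : ∀ e : ↥(fineBlock N) × σ, (sclFld N (u + t) e = x + (N : ℤ) • t) ↔ (sclFld N u e = x) := by
    intro e
    simp only [sclFld, smul_add, hN]
    rw [add_right_comm, add_left_inj]
  have hinj : Function.Injective (fun ℓ : Pt × Fin 4 => (ℓ.1 + (N : ℤ) • t, ℓ.2)) := by
    intro ℓ ℓ' h
    simp only [Prod.mk.injEq, add_left_inj] at h
    exact Prod.ext h.1 h.2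
  -- `ker₁` counts with the `DecidableEq`-derived `BEq`; `List.count_map_of_injective` is stated for the synthesized one — they agree (lawful)
  have hBEq : (instBEqOfDecidableEq : BEq (Pt × Fin 4)) = instBEqProd := lawful_beq_subsingleton _ _
  have hcount : ∀ e : ↥(fineBlock N) × σ,
      @List.count _ instBEqOfDecidableEq (b + (N : ℤ) • t, c) (sclBg N (u + t) rad e) = @List.count _ instBEqOfDecidableEq (b, c) (sclBg N u rad e) := by
    intro e
    rw [hBEq]
    simp only [sclBg, hradCov]
    exact List.count_map_of_injective _ _ hinj (b, c)
  refine Finset.sum_congr ?_ fun e _ => by rw [hcount]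
  ext e
  simp only [Finset.mem_filter, Finset.mem_univ, true_and, hfld]

/-- [folklore] the positional indicator is invariant under an injective relabelling of the letters. -/
theorem posInd_map_of_injective {B : Type*} [DecidableEq B] {f : B → B} (hf : Function.Injective f) (l : List B) (i : ℕ) (b : B) :
    posInd (l.map f) i (f b) = posInd l i b := by
  unfold posInd
  rw [List.getElem?_map]
  by_cases h : l[i]? = some b
  · rw [if_pos h, if_pos (by rw [h]; rfl)]
  · rw [if_neg h, if_neg ?_]
    intro h'
    apply h
    cases hl : l[i]? with
    | none => rw [hl] at h'; exact absurd h' (by simp)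
    | some a =>
        rw [hl] at h'
        simp only [Option.map_some, Option.some.injEq] at h'
        rw [hf h']

/-- [folklore] the ordered nested pair weight is invariant under an injective relabelling of the letters. -/
theorem pairW_map_of_injective {B : Type*} [DecidableEq B] {f : B → B} (hf : Function.Injective f) (l : List B) (b'' b' : B) :
    pairW (l.map f) (f b'') (f b') = pairW l b'' b' := by
  unfold pairW
  rw [List.length_map]
  simp only [posInd_map_of_injective hf]

/-- [folklore] **THE BOND-LETTER SECOND-JET KERNEL IS BLOCK COVARIANT** under (radCov): `ker₂^{(u+t)} (b″+N•t, c) (b′+N•t, c′) (x+N•t) = ker₂^{(u)} (b″, c) (b′, c′) x`. -/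
theorem ker₂_bond_shift
    (hradCov : ∀ (s : σ) (u t x' : Pt), rad s (u + t) x' = (rad s u x').map (fun ℓ => (ℓ.1 + (N : ℤ) • t, ℓ.2)))
    (b'' b' x : Pt) (c c' : Fin 4) (u t : Pt) :
    ker₂ (sclW N p) (sclFld N (u + t)) (sclBg N (u + t) rad) (b'' + (N : ℤ) • t, c) (b' + (N : ℤ) • t, c') (x + (N : ℤ) • t)
      = ker₂ (sclW N p) (sclFld N u) (sclBg N u rad) (b'', c) (b', c') x := by
  classical
  unfold ker₂
  have hN : ((N : ℕ) • t : Pt) = (N : ℤ) • t := (Nat.cast_smul_eq_nsmul ℤ N t).symm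
  have hfld : ∀ e : ↥(fineBlock N) × σ, (sclFld N (u + t) e = x + (N : ℤ) • t) ↔ (sclFld N u e = x) := by
    intro e
    simp only [sclFld, smul_add, hN]
    rw [add_right_comm, add_left_inj]
  have hinj : Function.Injective (fun ℓ : Pt × Fin 4 => (ℓ.1 + (N : ℤ) • t, ℓ.2)) := by
    intro ℓ ℓ' h
    simp only [Prod.mk.injEq, add_left_inj] at h
    exact Prod.ext h.1 h.2
  have hpair : ∀ e : ↥(fineBlock N) × σ,
      pairW (sclBg N (u + t) rad e) (b'' + (N : ℤ) • t, c) (b' + (N : ℤ) • t, c') = pairW (sclBg N u rad e) (b'', c) (b', c') := by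
    intro e
    simp only [sclBg, hradCov]
    exact pairW_map_of_injective hinj _ (b'', c) (b', c')
  refine Finset.sum_congr ?_ fun e _ => by rw [hpair]
  ext e
  simp only [Finset.mem_filter, Finset.mem_univ, true_and, hfld]

end Summit.QuantumFields.BalabanUV.Beta.FP.BondFamilyCovariance

end
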